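import Summits.BirchSwinnertonDyer.BirchSwinnertonDyer.Theorems.PrintCFramBottomClassIndexLawFiveLeEisensteinEndStateV19Primitivity
import Summits.BirchSwinnertonDyer.BirchSwinnertonDyer.Theorems.PrintCFramBottomClassIndexLawFiveLeHeegnerTwistShaSupply
import HarnessLib

/-!
# Crux `PrintCFram.BottomClassIndexLawFiveLe` (stmt-BirchSwinnertonDyer-20372), line `eisenstein-resource-bdp-line` (registry v19/v20):
# END STATE WITH ALL THREE RESEARCH HYPOTHESES IN Ш / HEEGNER-POINT CURRENCY — crux ⟸ prints4 ∧ Mazur–Wiles Thm 2 ∧ Kriz–Li Thm 1.20 ∧ C_Ш ∧ B1-sha ∧ B1-prim,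
# where ONE twist supply C_Ш (w5 g4) serves BOTH Stub C (via `HeegnerTwistSha.stubC_of_heegnerTwistShaSupply`) and the Kolyvagin reading's C♭_Ш (this seat);
# and conversely crux ∧ (R-IMC)∃-Zp ⟹ B1-sha ∧ B1-prim

Cell `bsd-print-cfram`, width seat `bsd-line-cfram-p1-w3` g10, `--supports stmt-BirchSwinnertonDyer-20372` (helper). THEOREMS ONLY; no definition, no
named fact, no `sorry`. BSD is not proved by any of this; no summit statement is proved by this seat; no stub is closed; the crux stays OPEN and is NOT
claimed false. Composition of this seat's `…EisensteinEndStateV19Primitivity` / `…ParitySplitPrimitivityBinders` (B1 ⟸ B1-sha ∧ B1-prim ∧ C♭_Ш, MW-free)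
with w5 g4's `…HeegnerTwistShaSupply` (Stub C ⟸ C_Ш, modulo Mazur–Wiles Thm 2 and GZK). TEXTS: B1-sha (LEAD g11 = v20 `stub_bsdp_of_sha`), B1-prim (this seat,
character-free Kolyvagin first layer), **C_Ш** (w5 g4, VERBATIM the hypothesis `hSupply` of `HeegnerTwistSha.stubC_of_heegnerTwistShaSupply`): «every rank-one
class member has an admissible Heegner `K` (`d_K` odd `< −4`, `L(W^{(d_K)},1) ≠ 0`) and a globally minimal model `Wd` of the twist with `Ш(Wd/ℚ)[p] = 0` and
`Ш(W₁/ℚ)[p] = 0` for every CM-ramified `p`-isogenous partner `W₁` of `Wd`».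

* §1 `twistSupply_of_shaSupply` — C_Ш ⟹ C♭_Ш (drop the partner clause and the restriction to `Ш(W)[p] = 0`).
* §2 `bottomClassIndexLawFiveLe_of_prints4_of_mazurWiles_of_krizLi_of_shaSupply_of_sha_of_heegnerIndex` — **END STATE: crux ⟸ prints4 ∧ MW Thm 2 ∧ KL Thm 1.20 ∧
  C_Ш ∧ B1-sha ∧ B1-prim** — three research hypotheses, all on class members, NO character, NO Bernoulli number, NO Selmer count, NO `p`-adic level:
  one admissible `p`-regular twist per member; `BSD_p` when `Ш[p] ≠ 0`; Heegner `p`-primitivity when `Ш[p] = 0`. (Companion of w5 g4's announced F3 with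
  B1-level in place of B1-prim.)
* §3 `bottomClassIndexLawFiveLe_iff_sha_and_heegnerIndex_of_shaSupply` — modulo prints4 ∧ MW ∧ KL ∧ C_Ш ∧ (R-IMC)∃-Zp, **crux ⟺ B1-sha ∧ B1-prim**.

References: crux workfiles `Lines/eisenstein_resource_bdp_line.lean` (v20), `Lines/eisenstein-resource-bdp-line-lead-g11.md` §5, `…-w3g9-notes.md` §2(c); HOME STATUS
w5 g4 2026-08-28T23:57:14Z (C_Ш), LEAD g12 2026-08-29T00:00:49Z (v20). CONDITIONAL on everything displayed.
-/

open scoped Classical Pointwise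

set_option linter.dupNamespace false
set_option autoImplicit false

noncomputable section

namespace Summit.BirchSwinnertonDyer.BirchSwinnertonDyer.Theorems.PrintCFram.EisensteinEndStateV19Primitivity

open WeierstrassCurve NumberField
  Literature.NumberTheory.EllipticCurves
  Literature.NumberTheory.EllipticCurves.ModularForms
  Literature.NumberTheory.EllipticCurves.Rank1Residual
  Literature.NumberTheory.EllipticCurves.Rank1Residual.Typed
  Literature.NumberTheory.EllipticCurves.KrizLi2019
  Literature.NumberTheory.NumberFields
  Summit.BirchSwinnertonDyer.Rank1Residual
  Summit.BirchSwinnertonDyer.Rank1Residual.X12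
  Summit.BirchSwinnertonDyer.BirchSwinnertonDyer.Theses.UniversalToricDescent
  Summit.BirchSwinnertonDyer.BirchSwinnertonDyer.Theorems
  Summit.BirchSwinnertonDyer.BirchSwinnertonDyer.Theorems.PrintCFram

/-! ## §1 C_Ш ⟹ C♭_Ш -/

/-- **w5 g4's twist supply C_Ш implies this seat's C♭_Ш**: forget the `p`-isogenous-partner clause (and the supply is asked of every rank-one member, in
particular of those with `Ш(W/ℚ)[p] = 0`). [cite: GrossZagier1986, I.§4] -/
theorem twistSupply_of_shaSupply
    (hSupply :
    ∀ (W : WeierstrassCurve ℚ) [W.IsElliptic] [W.IsGloballyMinimal] (p : ℕ) [Fact p.Prime],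
      W.HasCM → CMRamified W p → 5 ≤ p → W.analyticRank = 1 →
      ∃ (K : Type) (_ : Field K) (_ : NumberField K), IsImaginaryQuadratic K ∧
        SatisfiesHeegnerHypothesis (W.conductorNorm ℤ) K ∧ Odd (NumberField.discr K) ∧ NumberField.discr K < -4 ∧
        (W.quadraticTwist (NumberField.discr K : ℚ)).entireLFunction 1 ≠ 0 ∧
        ∃ (Wd : WeierstrassCurve ℚ) (_ : Wd.IsElliptic) (_ : Wd.IsGloballyMinimal),
          (∃ C : VariableChange ℚ, C • W.quadraticTwist (NumberField.discr K : ℚ) = Wd) ∧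
          (∀ c ∈ Wd.sha, p • c = 0 → c = 0) ∧
          (∀ (W₁ : WeierstrassCurve ℚ) [W₁.IsElliptic] [W₁.IsGloballyMinimal], W₁.HasCM → CMRamified W₁ p →
            (∃ φ : Isogeny Wd W₁, φ.degree = p) → ∀ c ∈ W₁.sha, p • c = 0 → c = 0)) :
    ∀ (W : WeierstrassCurve ℚ) [W.IsElliptic] [W.IsGloballyMinimal] (p : ℕ) [Fact p.Prime],
      W.HasCM → CMRamified W p → 5 ≤ p → W.analyticRank = 1 →
      (∀ s ∈ W.sha, p • s = 0 → s = 0) →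
      ∃ (K : Type) (_ : Field K) (_ : NumberField K),
        IsImaginaryQuadratic K ∧ SatisfiesHeegnerHypothesis (W.conductorNorm ℤ) K ∧ Odd (NumberField.discr K) ∧
        NumberField.discr K < -4 ∧ (W.quadraticTwist (NumberField.discr K : ℚ)).entireLFunction 1 ≠ 0 ∧
        ∃ (Wd : WeierstrassCurve ℚ) (_ : Wd.IsElliptic) (_ : Wd.IsGloballyMinimal),
          (∃ C : VariableChange ℚ, C • W.quadraticTwist (NumberField.discr K : ℚ) = Wd) ∧
          ∀ s ∈ Wd.sha, p • s = 0 → s = 0 := by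
  intro W _ _ p _ hCM hram h5 hr _
  obtain ⟨K, iK, iK', hK, hH, hodd, hd4, hLt, Wd, iWd, iWd', hC, hsha, -⟩ := hSupply W p hCM hram h5 hr
  exact ⟨K, iK, iK', hK, hH, hodd, hd4, hLt, Wd, iWd, iWd', hC, hsha⟩

/-! ## §2 END STATE: crux ⟸ prints4 ∧ MW ∧ KL ∧ C_Ш ∧ B1-sha ∧ B1-prim -/

/-- **END STATE IN Ш / HEEGNER-POINT CURRENCY.** The crux `BottomClassIndexLawFiveLe` follows from: (1) `hprints4` — the four print facts; (2) `hMW` —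
Mazur–Wiles 1984 Thm. 2 (a fifth refereed print fact, used only to turn C_Ш into Stub C, w5 g4); (3) `hKL` — Kriz–Li 2019 Thm. 1.20; and THREE research
statements on class members — (4) **C_Ш** (`hSupply`, w5 g4: one admissible `p`-regular Heegner twist per rank-one member, with the partner clause);
(5) **B1-sha** (`BSD_p` when `Ш[p] ≠ 0`); (6) **B1-prim** (Heegner `p`-primitivity up to the Manin-type constant when `Ш[p] = 0`). Proof: Stub C from C_Ш
(`HeegnerTwistSha.stubC_of_heegnerTwistShaSupply`), B1 from B1-sha ∧ B1-prim ∧ C♭_Ш (`ParitySplit.stubB1_of_sha_of_heegnerIndex_of_twistSupply`, C♭_Ш by §1),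
then END STATE v19 (`EisensteinEndStateV19.bottomClassIndexLawFiveLe_of_prints4_of_krizLi_of_classFactor_of_cover`). CONDITIONAL on (1)–(6); BSD is not proved
by any of this; the crux stays OPEN. [cite: KrizLi2019, Thm. 1.20 (pp. 7–8), §8 (pp. 49–52)] [cite: MazurWiles1984, Thm. 2 (p. 216)]
[cite: GrossZagier1986, I.§4, Thm. I.(6.3) and V.§2 (pp. 310–312)] [cite: Kolyvagin1990, Thm. A] [cite: BurungaleFlach2024, Thm. 1.1 and Cor. 2] -/
theorem bottomClassIndexLawFiveLe_of_prints4_of_mazurWiles_of_krizLi_of_shaSupply_of_sha_of_heegnerIndex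
    (hprints4 :
    Hsieh2014.thmA_exists_isHsiehLFunction_unrPeriod_anyLevel ∧
    LiuZhangZhang2018.thm151_thm153_modularCurve_heegnerVector_additive ∧
    Summit.BirchSwinnertonDyer.BirchSwinnertonDyer.Theses.UniversalToricDescent.ToricPublishedInputs ∧
    bsdTriple_of_hasCM_of_L_one_ne_zero)
    (hMW : MazurWiles1984.thm2_card_oddChiClassGroup_eq_bernoulli)
    (hKL : thm120_padicLogHeegner_unit_of_bernoulli)
    (hSupply :
    ∀ (W : WeierstrassCurve ℚ) [W.IsElliptic] [W.IsGloballyMinimal] (p : ℕ) [Fact p.Prime],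
      W.HasCM → CMRamified W p → 5 ≤ p → W.analyticRank = 1 →
      ∃ (K : Type) (_ : Field K) (_ : NumberField K), IsImaginaryQuadratic K ∧
        SatisfiesHeegnerHypothesis (W.conductorNorm ℤ) K ∧ Odd (NumberField.discr K) ∧ NumberField.discr K < -4 ∧
        (W.quadraticTwist (NumberField.discr K : ℚ)).entireLFunction 1 ≠ 0 ∧
        ∃ (Wd : WeierstrassCurve ℚ) (_ : Wd.IsElliptic) (_ : Wd.IsGloballyMinimal),
          (∃ C : VariableChange ℚ, C • W.quadraticTwist (NumberField.discr K : ℚ) = Wd) ∧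
          (∀ c ∈ Wd.sha, p • c = 0 → c = 0) ∧
          (∀ (W₁ : WeierstrassCurve ℚ) [W₁.IsElliptic] [W₁.IsGloballyMinimal], W₁.HasCM → CMRamified W₁ p →
            (∃ φ : Isogeny Wd W₁, φ.degree = p) → ∀ c ∈ W₁.sha, p • c = 0 → c = 0))
    (hSha :
    ∀ (W : WeierstrassCurve ℚ) [W.IsElliptic] [W.IsGloballyMinimal] (p : ℕ) [Fact p.Prime],
      W.HasCM → CMRamified W p → 5 ≤ p → W.analyticRank = 1 →
      (∃ s ∈ W.sha, s ≠ 0 ∧ p • s = 0) → BSDp W p)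
    (hPrim :
    ∀ (W : WeierstrassCurve ℚ) [W.IsElliptic] [W.IsGloballyMinimal] (p : ℕ) [Fact p.Prime],
      W.HasCM → CMRamified W p → 5 ≤ p → W.analyticRank = 1 →
      (∀ s ∈ W.sha, p • s = 0 → s = 0) →
      ∀ (N : ℕ) [NeZero N] (K : Type) [Field K] [NumberField K]
        (Dt : ModularParametrizationData W N) (H : HeegnerDatum N (NumberField.discr K)) (ι : K →+* ℂ)
        (P : (W.baseChange K).toAffine.Point) (Wd : WeierstrassCurve ℚ) [Wd.IsElliptic] [Wd.IsGloballyMinimal],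
        W.conductorNorm ℤ = N → IsImaginaryQuadratic K → SatisfiesHeegnerHypothesis N K →
        Odd (NumberField.discr K) → NumberField.discr K < -4 →
        (W.quadraticTwist (NumberField.discr K : ℚ)).entireLFunction 1 ≠ 0 →
        WeierstrassCurve.Affine.Point.map ι.toRatAlgHom P = heegnerPointComplex Dt H →
        (∃ C : VariableChange ℚ, C • W.quadraticTwist (NumberField.discr K : ℚ) = Wd) →
        (∀ s ∈ Wd.sha, p • s = 0 → s = 0) →
        padicValNat p (AddSubgroup.zmultiples P).index = padicValNat p Dt.c.natAbs) :
    Summit.BirchSwinnertonDyer.BirchSwinnertonDyer.Theses.PrintCFram.BottomClassIndexLawFiveLe := by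
  obtain ⟨hGZ, hKo, hGZK, hmod, -, -, hGZ73, -, -, hHP⟩ := hprints4.2.2.1
  exact EisensteinEndStateV19.bottomClassIndexLawFiveLe_of_prints4_of_krizLi_of_classFactor_of_cover hprints4 hKL
    (ParitySplit.stubB1_of_sha_of_heegnerIndex_of_twistSupply hGZ hKo hGZK hmod hGZ73 hHP hprints4.2.2.2 hSha hPrim
      (twistSupply_of_shaSupply hSupply))
    (HeegnerTwistSha.stubC_of_heegnerTwistShaSupply hMW hGZK hSupply)

/-! ## §3 The iff in Ш / Heegner-point currency -/

/-- **CRUX ⟺ B1-sha ∧ B1-prim, modulo prints4 ∧ Mazur–Wiles Thm 2 ∧ Kriz–Li Thm 1.20 ∧ C_Ш ∧ (R-IMC)∃-Zp.** (⟸) §2; (⟹) `sha_of_bottomClassIndexLawFiveLe_of_imcZp`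
and `heegnerIndex_of_bottomClassIndexLawFiveLe_of_imcZp` (crux ∧ IMC ⟹ `BSD_p` class-wide ⟹ both). So on this line, granted print, ONE twist-supply statement
and the main-conjecture identity, **C2 is «`BSD_p` when `Ш[p] ≠ 0` ∧ Kolyvagin `p`-primitivity when `Ш[p] = 0`» on the rank-one CM-ramified class.**
CONDITIONAL; BSD is not proved by any of this; the crux stays OPEN. [cite: KrizLi2019, Thm. 1.20 (pp. 7–8)] [cite: MazurWiles1984, Thm. 2 (p. 216)]
[cite: BurungaleKobayashiNakamuraOta2026, Thm. 3.14 (3) and §1.4 (arXiv:2608.06879 pp. 22–24, 8)] [cite: GrossZagier1986, Thm. I.(6.3) and V.§2 (pp. 310–312)] -/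
theorem bottomClassIndexLawFiveLe_iff_sha_and_heegnerIndex_of_shaSupply
    (hprints4 :
    Hsieh2014.thmA_exists_isHsiehLFunction_unrPeriod_anyLevel ∧
    LiuZhangZhang2018.thm151_thm153_modularCurve_heegnerVector_additive ∧
    Summit.BirchSwinnertonDyer.BirchSwinnertonDyer.Theses.UniversalToricDescent.ToricPublishedInputs ∧
    bsdTriple_of_hasCM_of_L_one_ne_zero)
    (hMW : MazurWiles1984.thm2_card_oddChiClassGroup_eq_bernoulli)
    (hKL : thm120_padicLogHeegner_unit_of_bernoulli)
    (hSupply :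
    ∀ (W : WeierstrassCurve ℚ) [W.IsElliptic] [W.IsGloballyMinimal] (p : ℕ) [Fact p.Prime],
      W.HasCM → CMRamified W p → 5 ≤ p → W.analyticRank = 1 →
      ∃ (K : Type) (_ : Field K) (_ : NumberField K), IsImaginaryQuadratic K ∧
        SatisfiesHeegnerHypothesis (W.conductorNorm ℤ) K ∧ Odd (NumberField.discr K) ∧ NumberField.discr K < -4 ∧
        (W.quadraticTwist (NumberField.discr K : ℚ)).entireLFunction 1 ≠ 0 ∧
        ∃ (Wd : WeierstrassCurve ℚ) (_ : Wd.IsElliptic) (_ : Wd.IsGloballyMinimal),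
          (∃ C : VariableChange ℚ, C • W.quadraticTwist (NumberField.discr K : ℚ) = Wd) ∧
          (∀ c ∈ Wd.sha, p • c = 0 → c = 0) ∧
          (∀ (W₁ : WeierstrassCurve ℚ) [W₁.IsElliptic] [W₁.IsGloballyMinimal], W₁.HasCM → CMRamified W₁ p →
            (∃ φ : Isogeny Wd W₁, φ.degree = p) → ∀ c ∈ W₁.sha, p • c = 0 → c = 0))
    (hIMC : ∀ (W : WeierstrassCurve ℚ) [W.IsElliptic] [W.IsGloballyMinimal] (p : ℕ) [Fact p.Prime],
      W.HasCM → CMRamified W p → 5 ≤ p → W.analyticRank = 1 → O11.RamifiedCMEllipticUnitIMCAtZp W p) :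
    Summit.BirchSwinnertonDyer.BirchSwinnertonDyer.Theses.PrintCFram.BottomClassIndexLawFiveLe ↔
    ((∀ (W : WeierstrassCurve ℚ) [W.IsElliptic] [W.IsGloballyMinimal] (p : ℕ) [Fact p.Prime],
      W.HasCM → CMRamified W p → 5 ≤ p → W.analyticRank = 1 →
      (∃ s ∈ W.sha, s ≠ 0 ∧ p • s = 0) → BSDp W p) ∧
    (∀ (W : WeierstrassCurve ℚ) [W.IsElliptic] [W.IsGloballyMinimal] (p : ℕ) [Fact p.Prime],
      W.HasCM → CMRamified W p → 5 ≤ p → W.analyticRank = 1 →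
      (∀ s ∈ W.sha, p • s = 0 → s = 0) →
      ∀ (N : ℕ) [NeZero N] (K : Type) [Field K] [NumberField K]
        (Dt : ModularParametrizationData W N) (H : HeegnerDatum N (NumberField.discr K)) (ι : K →+* ℂ)
        (P : (W.baseChange K).toAffine.Point) (Wd : WeierstrassCurve ℚ) [Wd.IsElliptic] [Wd.IsGloballyMinimal],
        W.conductorNorm ℤ = N → IsImaginaryQuadratic K → SatisfiesHeegnerHypothesis N K →
        Odd (NumberField.discr K) → NumberField.discr K < -4 →
        (W.quadraticTwist (NumberField.discr K : ℚ)).entireLFunction 1 ≠ 0 →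
        WeierstrassCurve.Affine.Point.map ι.toRatAlgHom P = heegnerPointComplex Dt H →
        (∃ C : VariableChange ℚ, C • W.quadraticTwist (NumberField.discr K : ℚ) = Wd) →
        (∀ s ∈ Wd.sha, p • s = 0 → s = 0) →
        padicValNat p (AddSubgroup.zmultiples P).index = padicValNat p Dt.c.natAbs)) :=
  ⟨fun hcrux ↦ ⟨sha_of_bottomClassIndexLawFiveLe_of_imcZp hprints4 hIMC hcrux,
      heegnerIndex_of_bottomClassIndexLawFiveLe_of_imcZp hprints4 hIMC hcrux⟩,
    fun h ↦ bottomClassIndexLawFiveLe_of_prints4_of_mazurWiles_of_krizLi_of_shaSupply_of_sha_of_heegnerIndex hprints4 hMW hKL hSupply h.1 h.2⟩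

end Summit.BirchSwinnertonDyer.BirchSwinnertonDyer.Theorems.PrintCFram.EisensteinEndStateV19Primitivity

end
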